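import Summits.BirchSwinnertonDyer.BirchSwinnertonDyer.Theorems.TeichmullerTwistDescentManinUnitFromKatoTwistInputs
import Summits.BirchSwinnertonDyer.BirchSwinnertonDyer.Theorems.TeichmullerTwistDescentCells57Residual
import HarnessLib

/-!
# Route `TeichmullerTwistDescent` (rev 2): PSMU (stmt-BirchSwinnertonDyer-22638) and SCMU57 (22639) from the
# REGISTERED items {PUB bundles, CORNER / LOW} by name; the cell decls GE11 (23885) granted F′ alone (= the PUB
# bundle 23789), CORNER (23883) and LOW (23884) granted modularity, F″ and L-TWIST

Cell `pub/bsd-wall` (D-0145 line route-BirchSwinnertonDyer-TeichmullerTwistDescent, OPEN rev 2 ef9588816b30),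
seat `bsd-line-ttd-p2` (prover 2/2, g2; holds PSMU 22638). THEOREMS ONLY (no definition, no named fact, no
`sorry`); all three are `proof.conditional` (cite-only / not-in-tree antecedents); no item is closed by this
file; BSD is not proved by this.

Rev 2 of the route split PSMU / SCMU57 along this seat's cells (p580436, p584032): GE11
`OrdinaryLowValuationOptimalManinUnitGeEleven` (`p ≥ 11`, (G)-ordinary, `ord_p Δ_min ≤ 4`), CORNER
`KummerCornerTorsionOptimalManinUnit` (III@5 / II@7, (G)-ordinary, a `ℚ_p`-rational point of order `p`), LOW
`SupersingularTorsionOptimalManinUnitFive` (`(p, ord_p Δ_min) ∈ {(5,2),(5,3),(7,2)}`, not (G)-ordinary, a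
`ℚ_p`-rational point of order `p`), all at a lattice-optimal CONDUCTOR-LEVEL datum. This file records what the
tree proves about each, by name:

* `ordinaryLowValuationOptimalManinUnitGeEleven_of_kato` — **GE11 ⟸ F′ alone** (F′ =
  `kato_neron_isIntegral_twistedSymbolSum_of_additive`, the `p > 7` Kato–Kosters–Pannekoek reading; no
  modularity needed since the datum is already at the conductor level, no (G)-ordinarity, no `ord_p Δ_min ≤ 4`,
  no twist-degree step TDS11): the FULL tame-twist lever `ManinFrameResidueProperRTameTwist.not_dvd_c_of_tameTwistL`
  (p573163, seat bsd-wall-manin-p1) at `p ≥ 11 > 7`, with `p² ∣ N(W)` (additivity) and `a_ℓ = ±1` at `ℓ ∥ N(W)`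
  (Kraus–Oesterlé). `…_of_kato57facts` — the same from F″ (which specialises to F′). So the route text's «TDS11
  22228 ⇒ this … ČNS otherwise» is not needed granted F′: GE11 is F′-conditional exactly like K★ 22226.
* `kummerCornerTorsionOptimalManinUnit_of_kato_of_periodTwist` — **CORNER ⟸ modularity ∧ F″ ∧ L-TWIST**
  (`not_dvd_c_of_kato_of_periodTwist`, p589716: TORS-TWIST is the tree theorem `TorsTwist.torsTwist57_input`).
* `supersingularTorsionOptimalManinUnitFive_of_kato_of_periodTwist` — **LOW ⟸ modularity ∧ F″ ∧ L-TWIST**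
  (same theorem; the Weil-type clause `¬ TypeGOrd` is idle).

* `ordinaryLowValuationOptimalManinUnitGeEleven_of_katoNeronAndCremonaFacts` — GE11 from the route's REGISTERED
  PUB bundle `KatoNeronAndCremonaFacts` (stmt-23789) alone.
* `principalSeriesOptimalManinUnit_of_items` — **PSMU (22638) ⟸ the REGISTERED items {KatoNeronAndCremonaFacts
  (23789), PublishedInputsAdditiveKoly (20137), CORNER (23883)}** — fewer than the planner's twin 23886 (no
  `PublishedManinFacts`, no GE11): `p > 7` by the full lever, `p ∈ {5, 7}` by `cellPS57_of_kato57_of_corner`.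
* `supercuspidalOptimalManinUnitFiveSeven_of_items` — SCMU57 (22639) ⟸ {23789, 20137, LOW (23884)} (the body of
  the twin 23887), by g0's `supercuspidalOptimalManinUnitFiveSeven_of_kato57_of_lowDiscriminant`.

HONEST STATUS: GE11 — one cite-only fact (F′, XL); CORNER / LOW — modularity (cite-only), F″ (cite-only, XL) and
L-TWIST (not in the tree; ⟸ Ihara's lemma, seats manin-p1 g6 / edix-p2 g2 / edix-p3 g2 on it, split (A)(B)(C)
of 2026-08-28T00:27Z). Granted F″ alone CORNER / LOW hold up to ONE factor `p`
(`TeichmullerTwistDescentManinAtMostOnceFiveLe.lean`). Nothing is closed; BSD is not proved by this.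
[cite: Kato2004Asterisque, (8.1.3) (p. 180), Thm. 9.7 (p. 189)] [cite: KimNakamura2020, Thm. 2.1, Cor. 2.4]
[cite: KostersPannekoek2017, Thm. 1 and Cor. 2] [cite: KrausOesterle1992, §3 Lemme 1]
[cite: Stevens1989, Lemma (5.2) p. 96] [cite: EdixhovenManin1991, Thm. 3 and §4]
-/

set_option autoImplicit false
-- single-conjunct summit: `Summit.BirchSwinnertonDyer.BirchSwinnertonDyer.…` repeats the name by design
set_option linter.dupNamespace false

noncomputable section

open scoped Classical MatrixGroups

open WeierstrassCurve IsDedekindDomain Rat.HeightOneSpectrum NumberField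
  Literature.NumberTheory.EllipticCurves Literature.NumberTheory.EllipticCurves.ModularForms
  Literature.NumberTheory.EllipticCurves.Rank1Residual Literature.NumberTheory.DiophantineGeometry
  Summit.BirchSwinnertonDyer.Rank1Residual Summit.BirchSwinnertonDyer.Rank1Residual.Additive
  Summit.BirchSwinnertonDyer.BirchSwinnertonDyer.Theses.TeichmullerTwistDescent
  Summit.BirchSwinnertonDyer.BirchSwinnertonDyer.Theorems CongruenceSubgroup

namespace Summit.BirchSwinnertonDyer.BirchSwinnertonDyer.Theorems.TeichmullerTwistDescent

/-! ### GE11 (stmt-BirchSwinnertonDyer-23885) granted F′ alone -/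

/-- **GE11 `OrdinaryLowValuationOptimalManinUnitGeEleven` (stmt-BirchSwinnertonDyer-23885) GRANTED F′ ALONE.**
For `W/ℚ` globally minimal, additive at `p ≥ 11` with `E[p]` irreducible and `D` a lattice-optimal datum at the
CONDUCTOR level: `p ∤ c(D)` — by the full tame-twist lever `not_dvd_c_of_tameTwistL` (`p > 7`; `p² ∣ N(W)` by
additivity; `a_ℓ(W) = ±1` at every `ℓ ∥ N(W)`, Kraus–Oesterlé). The hypotheses `TypeGOrd W p` and
`ord_p Δ_min(W) ≤ 4` of the decl are NOT used; modularity is NOT used (the level is the conductor by fiat).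
CONDITIONAL on the cite-only fact F′ = `kato_neron_isIntegral_twistedSymbolSum_of_additive` (Kato (8.1.3)/9.7/6.6
+ Kim–Nakamura 2.1/2.4, `p > 7`: no Kosters–Pannekoek clause); the item is not closed by this; BSD is not proved
by this. [cite: Kato2004Asterisque, (8.1.3) (p. 180), Thm. 9.7 (p. 189)] [cite: KimNakamura2020, Cor. 2.4]
[cite: KrausOesterle1992, §3 Lemme 1] -/
theorem ordinaryLowValuationOptimalManinUnitGeEleven_of_kato
    (hK' : kato_neron_isIntegral_twistedSymbolSum_of_additive) :
    OrdinaryLowValuationOptimalManinUnitGeEleven := by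
  intro W _ _ p _ _ D h11 hadd hirr _ _ hlat
  exact ManinFrameResidueProperRTameTwist.not_dvd_c_of_tameTwistL hK' W D hlat (by omega) hadd hirr
    (sq_dvd_conductorNorm_of_not_good_of_not_mult hadd) (lFunction_eq_one_or_neg_one_of_exactly_dvd_conductorNorm W)

/-- **GE11 GRANTED F″** (the route's PUB bundle `KatoNeronAndCremonaFacts` carries F″, which specialises to F′:
`KatoLever.kato_neron_of_five_le`). CONDITIONAL; nothing closed; BSD is not proved by this.
[cite: Kato2004Asterisque, (8.1.3) (p. 180), Thm. 9.7 (p. 189)] -/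
theorem ordinaryLowValuationOptimalManinUnitGeEleven_of_kato57facts
    (hK : kato_neron_isIntegral_twistedSymbolSum_of_additive_five_le) :
    OrdinaryLowValuationOptimalManinUnitGeEleven :=
  ordinaryLowValuationOptimalManinUnitGeEleven_of_kato
    (Cruxes.StarredOptimalManinUnitFiveSeven.KatoLever.kato_neron_of_five_le hK)

/-- **GE11 from the route's own PUB bundle** `KatoNeronAndCremonaFacts` (stmt-BirchSwinnertonDyer-23789; only its
F″ component is used). This is the shape a twin `KatoNeronAndCremonaFacts → OrdinaryLowValuationOptimalManinUnitGeEleven`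
would close by `exact`. CONDITIONAL (hypothesis-only bundle); BSD is not proved by this.
[cite: Kato2004Asterisque, (8.1.3) (p. 180), Thm. 9.7 (p. 189)] -/
theorem ordinaryLowValuationOptimalManinUnitGeEleven_of_katoNeronAndCremonaFacts
    (hKC : KatoNeronAndCremonaFacts) : OrdinaryLowValuationOptimalManinUnitGeEleven :=
  ordinaryLowValuationOptimalManinUnitGeEleven_of_kato57facts hKC.1

/-! ### CORNER (stmt-BirchSwinnertonDyer-23883) and LOW (stmt-BirchSwinnertonDyer-23884) granted modularity,
F″ and L-TWIST -/

/-- **CORNER `KummerCornerTorsionOptimalManinUnit` (stmt-BirchSwinnertonDyer-23883) GRANTED modularity, F″ and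
L-TWIST** — by `not_dvd_c_of_kato_of_periodTwist` (every lattice-optimal datum, `p ≥ 5` additive, `E[p]`
irreducible; TORS-TWIST is the tree theorem `TorsTwist.torsTwist57_input`); the decl's (G)-ordinarity, Kodaira
and torsion clauses are idle. CONDITIONAL (`hnf`, `hK` cite-only; `hLT` not in the tree); the item is not
closed by this; BSD is not proved by this. [cite: Kato2004Asterisque, (8.1.3) (p. 180), Thm. 9.7 (p. 189)]
[cite: KostersPannekoek2017, Thm. 1 and Cor. 2] [cite: Stevens1989, Lemma (5.2) p. 96] -/
theorem kummerCornerTorsionOptimalManinUnit_of_kato_of_periodTwist (hnf : exists_isNewformOf)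
    (hK : kato_neron_isIntegral_twistedSymbolSum_of_additive_five_le)
    (hLT : ∀ (p : ℕ) [Fact p.Prime] (q : ℕ) [Fact q.Prime] (V₀ : WeierstrassCurve ℚ) [V₀.IsElliptic]
      [V₀.IsGloballyMinimal] [NeZero (V₀.conductorNorm ℤ)]
      (D₀ : ModularParametrizationData V₀ (V₀.conductorNorm ℤ)), 5 ≤ p → Irr V₀ p → q ≠ 2 → q ≠ p →
      ¬ q ∣ V₀.conductorNorm ℤ →
      ∀ (Vχ : WeierstrassCurve ℚ) [Vχ.IsElliptic] [Vχ.IsGloballyMinimal] (v : VariableChange ℚ),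
      v • V₀.quadraticTwist (((-1 : ℤ) ^ (q / 2) * q : ℤ) : ℚ) = Vχ →
      ∀ (s : ℂ), s ^ 2 = (((-1 : ℤ) ^ (q / 2) * q : ℤ) : ℂ) →
      ∀ (N' : ℕ) [NeZero N'] (g : CuspForm (Gamma0 N') 2), IsNewformOf Vχ g →
      ∀ z ∈ periodLattice D₀.f, ∃ w ∈ periodLattice g, ∃ y ∈ periodLattice D₀.f, z = s * w + (p : ℂ) * y) :
    KummerCornerTorsionOptimalManinUnit := by
  intro W _ _ p _ _ D hp hadd hirr _ _ hlat
  exact not_dvd_c_of_kato_of_periodTwist hnf hK hLT W p D (by rcases hp with ⟨rfl, -⟩ | ⟨rfl, -⟩ <;> norm_num)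
    hadd hirr hlat

/-- **LOW `SupersingularTorsionOptimalManinUnitFive` (stmt-BirchSwinnertonDyer-23884) GRANTED modularity, F″ and
L-TWIST** — by `not_dvd_c_of_kato_of_periodTwist`; the clauses `¬ TypeGOrd`, Kodaira and torsion are idle.
CONDITIONAL; the item is not closed by this; BSD is not proved by this.
[cite: Kato2004Asterisque, (8.1.3) (p. 180), Thm. 9.7 (p. 189)] [cite: KostersPannekoek2017, Thm. 1 and Cor. 2]
[cite: Stevens1989, Lemma (5.2) p. 96] -/
theorem supersingularTorsionOptimalManinUnitFive_of_kato_of_periodTwist (hnf : exists_isNewformOf)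
    (hK : kato_neron_isIntegral_twistedSymbolSum_of_additive_five_le)
    (hLT : ∀ (p : ℕ) [Fact p.Prime] (q : ℕ) [Fact q.Prime] (V₀ : WeierstrassCurve ℚ) [V₀.IsElliptic]
      [V₀.IsGloballyMinimal] [NeZero (V₀.conductorNorm ℤ)]
      (D₀ : ModularParametrizationData V₀ (V₀.conductorNorm ℤ)), 5 ≤ p → Irr V₀ p → q ≠ 2 → q ≠ p →
      ¬ q ∣ V₀.conductorNorm ℤ →
      ∀ (Vχ : WeierstrassCurve ℚ) [Vχ.IsElliptic] [Vχ.IsGloballyMinimal] (v : VariableChange ℚ),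
      v • V₀.quadraticTwist (((-1 : ℤ) ^ (q / 2) * q : ℤ) : ℚ) = Vχ →
      ∀ (s : ℂ), s ^ 2 = (((-1 : ℤ) ^ (q / 2) * q : ℤ) : ℂ) →
      ∀ (N' : ℕ) [NeZero N'] (g : CuspForm (Gamma0 N') 2), IsNewformOf Vχ g →
      ∀ z ∈ periodLattice D₀.f, ∃ w ∈ periodLattice g, ∃ y ∈ periodLattice D₀.f, z = s * w + (p : ℂ) * y) :
    SupersingularTorsionOptimalManinUnitFive := by
  intro W _ _ p _ _ D hp hadd hirr _ _ hlat
  exact not_dvd_c_of_kato_of_periodTwist hnf hK hLT W p D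
    (by rcases hp with ⟨rfl, -⟩ | ⟨rfl, -⟩ <;> norm_num) hadd hirr hlat

/-! ### PSMU (stmt-BirchSwinnertonDyer-22638) from REGISTERED items only: the PUB bundles and CORNER -/

/-- **PSMU `PrincipalSeriesOptimalManinUnit` (stmt-BirchSwinnertonDyer-22638) from three REGISTERED items of
the route: `KatoNeronAndCremonaFacts` (23789; only F″ is used), `PublishedInputsAdditiveKoly` (20137; only
modularity `exists_isNewformOf` is used) and CORNER `KummerCornerTorsionOptimalManinUnit` (23883).** Compared
with the planner's twin `PrincipalSeriesOptimalManinUnitOfCells` (23886: also `PublishedManinFacts` and GE11),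
Edixhoven's Kodaira fact and the `p ≥ 11` cell are NOT needed: at `p > 7` EVERY lattice-optimal datum is a Manin
unit by the full tame-twist lever with F′ := F″|_{p>7} (`not_dvd_c_of_tameTwistL`); at `p ∈ {5, 7}` the
(G)-ordinary class hypothesis is read on `W` (`typeGOrd_iff_of_isIsogenous`), the `Iₙ*`-free member gives
`W` no `Iₙ*` fibre (`forall_ne_Istar_of_member`), and `cellPS57_of_kato57_of_corner` (p584032) reduces to CORNER.
So PSMU ⟸ {23789, 20137, 23883} by name. BSD is not proved by this; CORNER is open (conditional on L-TWIST).
[cite: Kato2004Asterisque, (8.1.3) (p. 180), Thm. 9.7 (p. 189)] [cite: KostersPannekoek2017, Thm. 1 and Cor. 2]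
[cite: Mazur1977, Ch. III §5, Step 1, p. 158] [cite: KrausOesterle1992, §3 Lemme 1] -/
theorem principalSeriesOptimalManinUnit_of_items (hKC : KatoNeronAndCremonaFacts)
    (hP : PublishedInputsAdditiveKoly) (hc : KummerCornerTorsionOptimalManinUnit) :
    PrincipalSeriesOptimalManinUnit := by
  intro W _ _ p hp N _ D hp5 hadd hirr hG hI hlat
  have hpP : p.Prime := hp.out
  have hp2 : p ≠ 2 := by omega
  have hnf : exists_isNewformOf := hP.2.2.2.2.2.1
  have hK : kato_neron_isIntegral_twistedSymbolSum_of_additive_five_le := hKC.1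
  -- the level of the datum is the conductor (Carayol, from modularity)
  have hN : N = W.conductorNorm ℤ :=
    IsNewformOf.level_eq_conductorNorm_of_exists_isNewformOf hnf D.isNewformOf
  subst hN
  rcases Nat.lt_or_ge 7 p with h7 | h7
  · -- `p > 7`: every lattice-optimal datum is a Manin unit (full lever, F′ := F″|_{p>7})
    exact ManinFrameResidueProperRTameTwist.not_dvd_c_of_tameTwistL
      (Cruxes.StarredOptimalManinUnitFiveSeven.KatoLever.kato_neron_of_five_le hK) W D hlat h7 hadd hirr
      (sq_dvd_conductorNorm_of_not_good_of_not_mult hadd) (lFunction_eq_one_or_neg_one_of_exactly_dvd_conductorNorm W)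
  · have hp57 : p = 5 ∨ p = 7 := by
      interval_cases p <;>
        first | exact Or.inl rfl | exact Or.inr rfl | exact absurd hpP (by decide)
    -- `(G)`-ordinarity and the absence of `Iₙ*` fibres, read on `W`
    obtain ⟨W', hE', hM', hiso', hG'⟩ := hG
    haveI := hE'
    haveI := hM'
    have hGW : TypeGOrd W p := (typeGOrd_iff_of_isIsogenous hp2 hadd hiso').mpr hG'
    have hIW : ∀ n : ℕ, W.kodairaSymbolAt (placeOf p) ≠ .Istar n := forall_ne_Istar_of_member W p hp2 hI
    exact cellPS57_of_kato57_of_corner hK hc W p D hp57 hadd hirr hGW hIW hlat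

/-- **SCMU57 `SupercuspidalOptimalManinUnitFiveSeven` (stmt-BirchSwinnertonDyer-22639) from the REGISTERED items
`KatoNeronAndCremonaFacts` (23789), `PublishedInputsAdditiveKoly` (20137) and LOW
`SupersingularTorsionOptimalManinUnitFive` (23884)** — the body of the planner's twin
`SupercuspidalOptimalManinUnitFiveSevenOfCell` (23887), by this seat's g0 theorem
`supercuspidalOptimalManinUnitFiveSeven_of_kato57_of_lowDiscriminant` (p584032). BSD is not proved by this;
LOW is open (conditional on L-TWIST). [cite: KostersPannekoek2017, Cor. 2] [cite: Mazur1977, Ch. III §5, Step 1] -/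
theorem supercuspidalOptimalManinUnitFiveSeven_of_items (hKC : KatoNeronAndCremonaFacts)
    (hP : PublishedInputsAdditiveKoly) (hl : SupersingularTorsionOptimalManinUnitFive) :
    SupercuspidalOptimalManinUnitFiveSeven :=
  supercuspidalOptimalManinUnitFiveSeven_of_kato57_of_lowDiscriminant hP.2.2.2.2.2.1 hKC.1 hl

end Summit.BirchSwinnertonDyer.BirchSwinnertonDyer.Theorems.TeichmullerTwistDescent

end
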